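import Summits.QuantumFields.YangMills.Theorems.BalabanUVNodesN15KingModelBoxSumRulesResolvent
import Summits.QuantumFields.YangMills.Theorems.BalabanUVNodesN15KingModelTorusFreeEnergyMassDerivative
import Mathlib.Analysis.Convex.Deriv
import HarnessLib

/-!
# BalabanUVNodes ∕ N15 — THE KING-MODEL RUNG (PART Ϟ-t): THE MASS DERIVATIVE OF KING's TORUS COVARIANCE `∂_{m²}G_T(x,y) = −Σ_zG_T(x,z)G_T(z,y)`, THE COVARIANCE ACTING ON PLANE
# WAVES `Σ_zG_T(w,z)e^{iq·z} = lapSym(q)⁻¹e^{iq·w}`, `G_T²` IN PLANE WAVES, AND THE STRICT CONCAVITY OF THE PERIODIC FREE ENERGY DENSITY IN `m²`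
# (`∂²_{m²}(|T|⁻¹ln det(c(−Δ)+m²)) = −Σ_zG_T(x,z)² < 0`) (Track A, DAG node N15 = NE2; FAN-OUT v1.1 §N15 s3 «KING-MODEL RUNG»; King (2.17) p.653, (4.4)∕(4.35) pp.670∕674; count-neutral)

HONEST FRAMING.  Count-neutral (cell `pub-ymgap`, seat `pub-ymgap-dag-n15-e` g41; K3ᴬ key **stmt-QuantumFields-27247** `--supports … --as helper` per KEY MAP v3 (the earlier parts of this
generation were booked under the aside K3⁸ 27366)).  TEMPLATE LITERATURE: C. King, Commun. Math. Phys. **102** (1986) 649–677 [King1986]: (2.13)∕(2.17) p.653, (3.89) p.668, (4.4) p.670,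
(4.35) p.674 (plane waves).  Part Ε-e: `G_T(x,y) = |T|⁻¹Σ_q lapSym(q)⁻¹Re e^{iq·(x−y)}` (`lapF_inv_apply_eq_fourier`); part Ϟ-c: `(c(−Δ)+m²)e^{iq·} = lapSym(q)e^{iq·}` (`lapF_eigen_chi`); the
torus Jacobi formula `∂_{m²}(|T|⁻¹ln det) = G_T(x,x)` is `…TorusFreeEnergyMassDerivative`; part Ϻ: the matrix resolvent identity; part Ϟ-s: the box twin and the torus row sum.  THIS FILE:
§1 ★★ **`sum_lapF_inv_mul_chi`** (`Σ_zG_T(w,z)e^{iq·z} = lapSym(q)⁻¹e^{iq·w}`: `G·B = 1` against the eigen-equation), `chi_sub_right_eq_mul_neg` (`e^{iq·(z−y)} = e^{iq·z}e^{iq·(−y)}`), ★ `sum_lapF_inv_mul_chi_re`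
(`Σ_zG_T(x,z)Re e^{iq·(z−y)} = lapSym(q)⁻¹Re e^{iq·(x−y)}`), ★★ **`sum_lapF_inv_mul_lapF_inv_eq_fourier`** (`Σ_zG_T(x,z)G_T(z,y) = |T|⁻¹Σ_q lapSym(q)⁻²Re e^{iq·(x−y)}`); §2 ★★★
**`hasDerivAt_lapF_inv`** (`∂_{m²}G_T(x,y) = −Σ_zG_T(x,z)G_T(z,y)` — term-by-term in plane waves), ★★ `hasDerivAt_lapF_inv_diag` (`= −Σ_zG_T(x,z)²`), ★ `sum_lapF_inv_sq_bounds`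
(`G_T(x,x)² ≤ Σ_zG_T(x,z)² ≤ 1∕m⁴`, Ϟ-s's row sum), `deriv_lapF_inv_diag_neg`; §3 ★★ **`hasDerivAt_deriv_log_det_lapF_div_card`** (`∂²_{m²}(|T|⁻¹ln det(c(−Δ)+m²)) = −Σ_zG_T(x,z)²`), ★★★
**`strictConcaveOn_log_det_lapF_div_card`** (the periodic free energy density is STRICTLY CONCAVE in `m² ∈ (0,∞)` on every torus, `c ≥ 0`).

PRIOR TREE ART (named, USED not restated): Ε-e (`lapF_inv_apply_eq_fourier`, `lapF_inv_diag_eq`, `inv_le_lapF_inv_diag`, `lapF_inv_diag_le_inv_mass`), Ϟ-c (`lapF_eigen_chi`), Ε-k (`det_lapF_pos`),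
`…TorusFreeEnergyMassDerivative` (`hasDerivAt_log_det_lapF_div_card`), Ϟ-s (`lapSym_eq_add_mass`, `sum_lapF_inv_eq_inv_mass`), Ν (`lapF_inv_comm`), `King1986` (`lapF`, `lapSym`, `lapSym_ge`,
`ProperTime.lapF_inv_nonneg`), `B5Prop11Plancherel` (`Tor`, `chi`, `chi_add_right`), Mathlib (`HasDerivAt.fun_sum`, `HasDerivAt.inv`, `strictConcaveOn_of_deriv2_neg'`).  NOT Bałaban's covariant
objects; NOT a node discharge (N15 is booked through n15-a's knit, untouched); nothing continuum-YM ∕ `ℝ⁴` ∕ OS ∕ Clay.  0 `sorry`; 0 `def`.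

HONEST SCOPE.  King's `A = 0` free periodic operator on `Πℤ∕K_μ` (dimension `d+1`), `c ≥ 0`, `m² > 0`; one-variable calculus in `m²`.  Locators: [King1986] (2.13)∕(2.17) p.653,
(3.89) p.668, (4.4) p.670, (4.35) p.674.
-/

noncomputable section

open scoped BigOperators Topology
open Finset Filter Matrix

namespace Summit.QuantumFields.YangMills.BalabanUVNodes.N15KingModelRung.TorusSpectral

open Literature.MathematicalPhysics.QuantumFieldTheory.Balaban1983to89.B5Prop11Plancherel (Tor chi chi_add_right)
open Literature.MathematicalPhysics.QuantumFieldTheory.King1986.Torus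
open Summit.QuantumFields.YangMills.BalabanUVNodes.N15KingModelRung.ProperTime (lapF_inv_nonneg)

variable {d : ℕ} (K : Fin (d + 1) → ℕ) [hK : ∀ i, NeZero (K i)] {c m2 : ℝ}

/-! ## §1 The covariance acting on plane waves; `G_T²` in plane waves -/

section PlaneWaves

/-- ★★ **THE COVARIANCE ACTING ON A PLANE WAVE**: `Σ_z G_T(w,z)e^{iq·z} = lapSym(q)⁻¹·e^{iq·w}` (`G_T·B = 1` against the eigen-equation `Be^{iq·} = lapSym(q)e^{iq·}`).
[cite: King1986, (4.4) p.670, (4.35) p.674] -/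
theorem sum_lapF_inv_mul_chi (hc : 0 ≤ c) (hm : 0 < m2) (q w : Tor K) :
    ∑ z, (((lapF K c m2)⁻¹ w z : ℝ) : ℂ) * chi K q z = (((lapSym K c m2 q)⁻¹ : ℝ) : ℂ) * chi K q w := by
  have hσ : (lapSym K c m2 q : ℂ) ≠ 0 := by exact_mod_cast (lt_of_lt_of_le hm (lapSym_ge K c m2 hc q)).ne'
  have hdet : IsUnit (lapF K c m2).det := isUnit_iff_ne_zero.mpr (det_lapF_pos K hc hm).ne'
  have hGA : ∀ y, ∑ z, (lapF K c m2)⁻¹ w z * lapF K c m2 z y = if w = y then 1 else 0 := fun y => by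
    have h := congrFun (congrFun (Matrix.nonsing_inv_mul (lapF K c m2) hdet) w) y
    rw [Matrix.mul_apply, Matrix.one_apply] at h
    exact h
  have hchi : ∀ z, chi K q z = (lapSym K c m2 q : ℂ)⁻¹ * ∑ y, (lapF K c m2 z y : ℂ) * chi K q y := fun z => by
    rw [lapF_eigen_chi K c m2 q z, ← mul_assoc, inv_mul_cancel₀ hσ, one_mul]
  calc ∑ z, (((lapF K c m2)⁻¹ w z : ℝ) : ℂ) * chi K q z
      = ∑ z, ∑ y, (lapSym K c m2 q : ℂ)⁻¹ * ((((lapF K c m2)⁻¹ w z : ℝ) : ℂ) * (lapF K c m2 z y : ℂ) * chi K q y) := by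
        refine Finset.sum_congr rfl fun z _ => ?_
        rw [hchi z, Finset.mul_sum, Finset.mul_sum]
        exact Finset.sum_congr rfl fun y _ => by ring
    _ = (lapSym K c m2 q : ℂ)⁻¹ * ∑ y, (((∑ z, (lapF K c m2)⁻¹ w z * lapF K c m2 z y : ℝ) : ℂ)) * chi K q y := by
        rw [Finset.sum_comm, Finset.mul_sum]
        refine Finset.sum_congr rfl fun y _ => ?_
        rw [Complex.ofReal_sum, Finset.sum_mul, Finset.mul_sum]
        exact Finset.sum_congr rfl fun z _ => by push_cast; ring
    _ = (((lapSym K c m2 q)⁻¹ : ℝ) : ℂ) * chi K q w := by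
        simp_rw [hGA]
        rw [Complex.ofReal_inv]
        congr 1
        rw [Finset.sum_eq_single w (fun y _ hy => by simp [hy.symm]) (fun h => absurd (Finset.mem_univ w) h)]
        simp

/-- `e^{iq·(z−y)} = e^{iq·z}·e^{iq·(−y)}`. [folklore] -/
theorem chi_sub_right_eq_mul_neg (q z y : Tor K) : chi K q (z - y) = chi K q z * chi K q (-y) := by
  rw [sub_eq_add_neg, chi_add_right]

/-- ★ real form against a shifted wave: `Σ_z G_T(x,z)·Re e^{iq·(z−y)} = lapSym(q)⁻¹·Re e^{iq·(x−y)}`. [cite: King1986, (4.4) p.670, (4.35) p.674] -/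
theorem sum_lapF_inv_mul_chi_re (hc : 0 ≤ c) (hm : 0 < m2) (q x y : Tor K) :
    ∑ z, (lapF K c m2)⁻¹ x z * (chi K q (z - y)).re = (lapSym K c m2 q)⁻¹ * (chi K q (x - y)).re := by
  have h : ∑ z, (((lapF K c m2)⁻¹ x z : ℝ) : ℂ) * chi K q (z - y) = (((lapSym K c m2 q)⁻¹ : ℝ) : ℂ) * chi K q (x - y) := by
    simp_rw [chi_sub_right_eq_mul_neg K q _ y, ← mul_assoc]
    rw [← Finset.sum_mul, sum_lapF_inv_mul_chi K hc hm q x]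
  have h' := congrArg Complex.re h
  rw [Complex.re_sum] at h'
  simp only [Complex.re_ofReal_mul] at h'
  exact h'

/-- ★★ **`G_T²` IN PLANE WAVES**: `Σ_z G_T(x,z)G_T(z,y) = |T|⁻¹Σ_q lapSym(q)⁻²·Re e^{iq·(x−y)}`. [cite: King1986, (2.17) p.653, (4.4) p.670, (4.35) p.674] -/
theorem sum_lapF_inv_mul_lapF_inv_eq_fourier (hc : 0 ≤ c) (hm : 0 < m2) (x y : Tor K) :
    ∑ z, (lapF K c m2)⁻¹ x z * (lapF K c m2)⁻¹ z y
      = (Fintype.card (Tor K) : ℝ)⁻¹ * ∑ q : Tor K, ((lapSym K c m2 q)⁻¹) ^ 2 * (chi K q (x - y)).re := by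
  calc ∑ z, (lapF K c m2)⁻¹ x z * (lapF K c m2)⁻¹ z y
      = ∑ z, ∑ q : Tor K, (Fintype.card (Tor K) : ℝ)⁻¹ * ((lapSym K c m2 q)⁻¹ * ((lapF K c m2)⁻¹ x z * (chi K q (z - y)).re)) := by
        refine Finset.sum_congr rfl fun z _ => ?_
        rw [lapF_inv_apply_eq_fourier K hc hm z y, Finset.mul_sum, Finset.mul_sum]
        exact Finset.sum_congr rfl fun q _ => by ring
    _ = (Fintype.card (Tor K) : ℝ)⁻¹ * ∑ q : Tor K, (lapSym K c m2 q)⁻¹ * ∑ z, (lapF K c m2)⁻¹ x z * (chi K q (z - y)).re := by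
        rw [Finset.sum_comm, Finset.mul_sum]
        exact Finset.sum_congr rfl fun q _ => by rw [Finset.mul_sum, Finset.mul_sum]
    _ = _ := by
        congr 1
        exact Finset.sum_congr rfl fun q _ => by rw [sum_lapF_inv_mul_chi_re K hc hm q x y, sq]; ring

end PlaneWaves

/-! ## §2 The mass derivative of the torus covariance -/

section Derivative

/-- ★★★ **THE MASS DERIVATIVE OF KING's TORUS COVARIANCE**: `∂_{m²}G_T(x,y) = −Σ_zG_T(x,z)G_T(z,y)` at every `m² > 0` (`c ≥ 0`; term-by-term in plane waves).
[cite: King1986, (2.17) p.653, (4.4) p.670, (4.35) p.674] -/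
theorem hasDerivAt_lapF_inv (hc : 0 ≤ c) (hm : 0 < m2) (x y : Tor K) :
    HasDerivAt (fun m : ℝ => (lapF K c m)⁻¹ x y) (-(∑ z, (lapF K c m2)⁻¹ x z * (lapF K c m2)⁻¹ z y)) m2 := by
  have hterm : ∀ q : Tor K, HasDerivAt (fun m : ℝ => (m + lapSym K c 0 q)⁻¹ * (chi K q (x - y)).re)
      (-(((m2 + lapSym K c 0 q)⁻¹) ^ 2 * (chi K q (x - y)).re)) m2 := by
    intro q
    have hlam : 0 ≤ lapSym K c 0 q := lapSym_ge K c 0 hc q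
    have hpos : m2 + lapSym K c 0 q ≠ 0 := by positivity
    have h1 : HasDerivAt (fun m : ℝ => m + lapSym K c 0 q) 1 m2 := (hasDerivAt_id m2).add_const _
    have h2 := (h1.inv hpos).mul_const ((chi K q (x - y)).re)
    have e : -(1 : ℝ) / (m2 + lapSym K c 0 q) ^ 2 * (chi K q (x - y)).re = -(((m2 + lapSym K c 0 q)⁻¹) ^ 2 * (chi K q (x - y)).re) := by
      rw [inv_pow]; ring
    rw [e] at h2
    exact h2
  have hsum := (HasDerivAt.fun_sum (u := Finset.univ) fun q _ => hterm q).const_mul ((Fintype.card (Tor K) : ℝ)⁻¹)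
  have hval : (Fintype.card (Tor K) : ℝ)⁻¹ * ∑ q ∈ Finset.univ, -(((m2 + lapSym K c 0 q)⁻¹) ^ 2 * (chi K q (x - y)).re)
      = -(∑ z, (lapF K c m2)⁻¹ x z * (lapF K c m2)⁻¹ z y) := by
    rw [sum_lapF_inv_mul_lapF_inv_eq_fourier K hc hm x y, ← mul_neg, ← Finset.sum_neg_distrib]
    congr 1
    exact Finset.sum_congr rfl fun q _ => by rw [← lapSym_eq_add_mass]
  rw [hval] at hsum
  refine hsum.congr_of_eventuallyEq ?_
  filter_upwards [Ioi_mem_nhds hm] with m hm'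
  rw [lapF_inv_apply_eq_fourier K hc hm' x y]
  congr 1
  exact Finset.sum_congr rfl fun q _ => by rw [← lapSym_eq_add_mass]

/-- ★★ on the diagonal: `∂_{m²}G_T(x,x) = −Σ_zG_T(x,z)²`. [cite: King1986, (2.17) p.653, (4.4) p.670] -/
theorem hasDerivAt_lapF_inv_diag (hc : 0 ≤ c) (hm : 0 < m2) (x : Tor K) :
    HasDerivAt (fun m : ℝ => (lapF K c m)⁻¹ x x) (-(∑ z, ((lapF K c m2)⁻¹ x z) ^ 2)) m2 := by
  have h := hasDerivAt_lapF_inv K hc hm x x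
  have e : ∑ z, (lapF K c m2)⁻¹ x z * (lapF K c m2)⁻¹ z x = ∑ z, ((lapF K c m2)⁻¹ x z) ^ 2 :=
    Finset.sum_congr rfl fun z _ => by rw [lapF_inv_comm K c m2 z x, sq]
  rwa [e] at h

/-- ★ `G_T(x,x)² ≤ Σ_zG_T(x,z)² ≤ 1∕m⁴` (one term; entries `≤ G_T(x,x) ≤ 1∕m²`-weighted row sum `1∕m²`). [cite: King1986, (2.17) p.653, (4.4) p.670] -/
theorem sum_lapF_inv_sq_bounds (hc : 0 ≤ c) (hm : 0 < m2) (x : Tor K) :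
    ((lapF K c m2)⁻¹ x x) ^ 2 ≤ ∑ z, ((lapF K c m2)⁻¹ x z) ^ 2 ∧ ∑ z, ((lapF K c m2)⁻¹ x z) ^ 2 ≤ m2⁻¹ * m2⁻¹ := by
  refine ⟨Finset.single_le_sum (fun z _ => sq_nonneg ((lapF K c m2)⁻¹ x z)) (Finset.mem_univ x), ?_⟩
  have hdiag : (lapF K c m2)⁻¹ x x ≤ m2⁻¹ := lapF_inv_diag_le_inv_mass K hc hm x
  calc ∑ z, ((lapF K c m2)⁻¹ x z) ^ 2 ≤ ∑ z, (lapF K c m2)⁻¹ x z * m2⁻¹ := Finset.sum_le_sum fun z _ => by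
          rw [sq]
          exact mul_le_mul_of_nonneg_left (((le_abs_self _).trans (abs_lapF_inv_le_diag K hc hm x z)).trans hdiag) (lapF_inv_nonneg K hc hm x z)
    _ = m2⁻¹ * m2⁻¹ := by rw [← Finset.sum_mul, sum_lapF_inv_eq_inv_mass K hc hm x]

/-- the derivative of the coincident-point covariance is STRICTLY negative: `∂_{m²}G_T(x,x) ≤ −G_T(x,x)² < 0`. [cite: King1986, (2.17) p.653, (4.4) p.670] -/
theorem deriv_lapF_inv_diag_neg (hc : 0 ≤ c) (hm : 0 < m2) (x : Tor K) : deriv (fun m : ℝ => (lapF K c m)⁻¹ x x) m2 < 0 := by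
  rw [(hasDerivAt_lapF_inv_diag K hc hm x).deriv, neg_lt_zero]
  have hpos : 0 < (lapF K c m2)⁻¹ x x := lt_of_lt_of_le (by positivity) (inv_le_lapF_inv_diag K hc hm x)
  exact lt_of_lt_of_le (pow_pos hpos 2) (sum_lapF_inv_sq_bounds K hc hm x).1

end Derivative

/-! ## §3 The periodic free energy density is strictly concave in the mass -/

section Concave

/-- ★★ **THE SECOND MASS DERIVATIVE OF THE FREE ENERGY DENSITY**: `∂²_{m²}(|T|⁻¹ln det(c(−Δ)+m²)) = −Σ_zG_T(x,z)²` at every `m² > 0` (Jacobi, then §2).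
[cite: King1986, (3.89) p.668, (2.17) p.653, (4.4) p.670] -/
theorem hasDerivAt_deriv_log_det_lapF_div_card (hc : 0 ≤ c) (hm : 0 < m2) (x : Tor K) :
    HasDerivAt (deriv fun m : ℝ => (Fintype.card (Tor K) : ℝ)⁻¹ * Real.log (lapF K c m).det) (-(∑ z, ((lapF K c m2)⁻¹ x z) ^ 2)) m2 := by
  refine (hasDerivAt_lapF_inv_diag K hc hm x).congr_of_eventuallyEq ?_
  filter_upwards [Ioi_mem_nhds hm] with m hm'
  exact (hasDerivAt_log_det_lapF_div_card K hc hm' x).deriv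

/-- ★★★ **THE PERIODIC FREE ENERGY DENSITY IS STRICTLY CONCAVE IN `m² ∈ (0,∞)`** on every torus (`c ≥ 0`): `deriv² = −Σ_zG_T(x,z)² < 0`. [cite: King1986, (3.89) p.668, (4.4) p.670] -/
theorem strictConcaveOn_log_det_lapF_div_card (hc : 0 ≤ c) :
    StrictConcaveOn ℝ (Set.Ioi 0) (fun m : ℝ => (Fintype.card (Tor K) : ℝ)⁻¹ * Real.log (lapF K c m).det) := by
  refine strictConcaveOn_of_deriv2_neg' (convex_Ioi 0) ?_ fun m hm => ?_
  · exact fun m hm => (hasDerivAt_log_det_lapF_div_card K hc hm (0 : Tor K)).continuousAt.continuousWithinAt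
  · rw [Function.iterate_succ_apply, Function.iterate_one, (hasDerivAt_deriv_log_det_lapF_div_card K hc hm (0 : Tor K)).deriv, neg_lt_zero]
    have hm' : 0 < m := hm
    have hpos : 0 < (lapF K c m)⁻¹ 0 0 := lt_of_lt_of_le (by positivity) (inv_le_lapF_inv_diag K hc hm' 0)
    exact lt_of_lt_of_le (pow_pos hpos 2) (sum_lapF_inv_sq_bounds K hc hm 0).1

end Concave

end Summit.QuantumFields.YangMills.BalabanUVNodes.N15KingModelRung.TorusSpectral

end
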